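import Summits.BirchSwinnertonDyer.Rank1Residual.GaloisImage.KolyvaginDerivativeEulerRelation
import HarnessLib

/-!
# Kolyvagin's derivative classes of an Euler system are Galois-invariant
# ([Rubin00] Lemma 4.4.2 for the tree's `IsEulerSystem`; THEOREM A2 of row T-DER)
# (cell `b2b-bsdres`, team n1011, seat p11 GEN 7, OWNERS row T-DER = skel/T-DER.md; file F3b)

HONEST FRAMING (cell `b2b-bsdres`, run/shared/lean/b2b/bsd-rank1-residual/, verbatim in every
file): the goal of the cell is to DELETE the COMBINATION-SHAPED residual classes of the
Birch–Swinnerton-Dyer formula for ALL analytic-rank `≤ 1` elliptic curves over `ℚ` — "full BSD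
formula for every rank `≤ 1` curve in class `C`" assembled STRICTLY from published theorems — so
that the rank-`≤ 1` remainder becomes exactly the CONSTRUCTION-SHAPED classes, which are TYPED
(missing-input `Prop`s), NOT attempted. This is not "finishing BSD". Team n1011 (N10 / N11, the
additive block X4 ∧ `p = 3`): research route on the CONSTRUCTION-SHAPED class X4; no claim beyond the
stated classes; nothing is booked. TOOL theorems of continuous Galois cohomology (no definition, no
named fact, no `sorry`); curve-free and `p`-free.

## What

Let `c` be an Euler system for `T` over the levels `L` (`IsEulerSystem L T p c`), `red : T ⟶ T'` an
equivariant continuous `A`-linear map to a representation `T'` (the intended `T → T/M`), `r` a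
finite set of usable primes, and for each `ℓ ∈ r` a chosen `σ_ℓ ∈ Γ_K` mapping to a generator of
the cyclic group `Γ_K ⧸ Gal(K̄/K(ℓ))` of order `N_ℓ` (`hcov`, `hinj`) and lying in `Gal(K̄/K(q))`
for the other `q ∈ r` (`hσ`), an arithmetic Frobenius `Fr_ℓ` (`hFr`) with `K(ℓ)·F(s)` ramified at
`ℓ` (`hram`, so that the Euler factor appears in the axiom), and suppose `T'` is killed by `N_ℓ`
and by `P_ℓ(1)` (`hM₁`, `hM₂`: "`ℓ ∈ 𝒫_M`", by name `Kato.IsKolyvaginPrime` for `T₃E`, see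
F3a's docstring).  Put `U_r = Gal(K̄/F_i(r))`, `X_r = H¹(U_r, T')`, let `σ_ℓ` act on `X_r` by
conjugation (`E_ℓ`), `D_ℓ = Σ_{j<N_ℓ} j E_ℓ^j`, `D_r = ∏_{ℓ∈r} D_ℓ` (a `Finset.noncommProd` of
commuting operators) and `x_r = red_* c_{i,r} ∈ X_r`.  THEN **`D_r x_r` is fixed by every
`g ∈ Γ_K`** (`conjMap_deriv_eq`) — Rubin, *Euler Systems*, Lemma 4.4.2:
"`D_r c_{F(r)} ∈ H¹(F(r), W_M)^{G_r}`".  This is THEOREM A2 of the row; A3 (descent to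
`H¹(K, T')` when `(T')^{U_r} = 0`) is the next file.

Structure of the proof: the family `x_s = red_* res^{U_s}_{U_r} c_{i,s}` (`s ⊆ r`) is an EULER
FAMILY in the sense of F1 (`Derivative.apply_noncommProd_deriv_apply_eq_of_eulerFamily`): `σ_ℓ`
fixes `x_s` for `ℓ ∉ s` (it lies in `U_s`), `σ_ℓ^{N_ℓ}` acts trivially (it lies in `U_r`), the NORM
RELATIONS are F3a's `sum_conjMap_pow_red_eq_aeval` (the Euler-system axiom after `res ∘ cor = Σ conj`
and `red_*`), `N_ℓ` and `P_ℓ(1)` kill `X_r` (F2 `smul_eq_zero_of_forall_smul_eq_zero`), and `Fr_ℓ⁻¹`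
fixes every vector fixed by the `σ_q` because the `σ_q` generate `Γ_K` modulo `U_r`
(`conjMap_eq_self_of_forall_sigma`, from F3a's `exists_mem_closure_inv_mul_mem`).  The version with this
last hypothesis DISPLAYED (referee-1 ACK-1 GEN 26 proviso (ii)) is `sigma_deriv_eq_of_hF`.

References: K. Rubin, *Euler Systems*, Annals of Math. Studies 147 (2000), Def. 4.4.1, Lemma 4.4.2;
B. Mazur, K. Rubin, *Kolyvagin systems*, Mem. AMS 799 (2004), App. A (32); V. A. Kolyvagin,
*Euler systems* (1990).
-/

noncomputable section

open CategoryTheory Function Finset Polynomial Field IsDedekindDomain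
open scoped NumberField Classical
open Literature.NumberTheory.GaloisRepresentations

universe u v w

namespace Summit.BirchSwinnertonDyer.Rank1Residual.GaloisImage

namespace Derivative

/-! ### The derivative classes -/

section Classes

variable {K : Type u} [Field K] [NumberField K] {ι : Type w} [Preorder ι] [OrderBot ι]
variable {A : Type v} [CommRing A] [TopologicalSpace A]
variable {M : Type u} [AddCommGroup M] [Module A M] [TopologicalSpace M] [IsTopologicalAddGroup M]
  [ContinuousSMul A M] [Module.Free A M] [Module.Finite A M]
variable {L : EulerSystemLevels K ι} {T : GaloisRep K A M} {p : ℕ} [Fact p.Prime] [Algebra ℤ_[p] A]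
variable {c : ∀ (i : ι) (r : L.Ideals), H1 T (L.level i r.1)}
variable {M' : Type u} [AddCommGroup M'] [Module A M'] [TopologicalSpace M'] [IsTopologicalAddGroup M']
  [ContinuousSMul A M'] {T' : GaloisRep K A M'}

/-- **A vector of `H¹(U_r, T')` fixed by all the chosen generators `σ_ℓ` (`ℓ ∈ r`) is fixed by all
of `Γ_K`** — the `σ_ℓ` generate `Γ_K` modulo `U_r` (`exists_mem_closure_inv_mul_mem`), elements of
`U_r` act trivially, and the fixed vectors of a set are fixed by the subgroup it generates.  This is
the discharge of F1's hypothesis (h4) "`F_ℓ` fixes every common fixed vector of the `σ`'s" for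
`F_ℓ = Fr_ℓ⁻¹` (referee-1 ACK-1 GEN 26 proviso (ii)). [folklore] -/
theorem conjMap_eq_self_of_forall_sigma (i : ι) (r : Finset (HeightOneSpectrum (𝓞 K)))
    (σ : HeightOneSpectrum (𝓞 K) → absoluteGaloisGroup K) (N : HeightOneSpectrum (𝓞 K) → ℕ)
    (hσp : ∀ ℓ ∈ r, σ ℓ ∈ L.pLevel i)
    (hσ : ∀ ℓ ∈ r, ∀ q ∈ r, q ≠ ℓ → σ ℓ ∈ L.tameLevel q)
    (hcov : ∀ ℓ ∈ r, ∀ g : absoluteGaloisGroup K, ∃ j < N ℓ, (σ ℓ ^ j)⁻¹ * g ∈ L.tameLevel ℓ)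
    (y : continuousCohomology 1 (subgroupRep T'.toTopRep (L.level i r)))
    (hy : ∀ q ∈ r, conjMap T'.toTopRep (L.level i r) (σ q) 1 y = y) (g : absoluteGaloisGroup K)
    (hg : g ∈ L.pLevel i) :
    conjMap T'.toTopRep (L.level i r) g 1 y = y := by
  obtain ⟨w, hw, hwq⟩ := exists_mem_closure_inv_mul_mem L σ N r hσ hcov g
  -- every element of the closure fixes `y` and lies in the `p`-level
  have hfix : ∀ w ∈ Subgroup.closure (σ '' (r : Set (HeightOneSpectrum (𝓞 K)))),
      conjMap T'.toTopRep (L.level i r) w 1 y = y ∧ w ∈ L.pLevel i := by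
    intro w hw
    induction hw using Subgroup.closure_induction with
    | mem x hx =>
      obtain ⟨q, hq, rfl⟩ := hx
      exact ⟨hy q (Finset.mem_coe.mp hq), hσp q (Finset.mem_coe.mp hq)⟩
    | one => exact ⟨conjMap_one_one _ _ y, Subgroup.one_mem _⟩
    | mul a b _ _ iha ihb =>
      refine ⟨?_, Subgroup.mul_mem _ iha.2 ihb.2⟩
      rw [← conjMap_conjMap, ihb.1, iha.1]
    | inv a _ iha =>
      refine ⟨?_, Subgroup.inv_mem _ iha.2⟩
      conv_lhs => rw [← iha.1]
      rw [conjMap_conjMap, inv_mul_cancel, conjMap_one_one]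
  obtain ⟨hwfix, hwp⟩ := hfix w hw
  have hmem : w⁻¹ * g ∈ L.level i r :=
    mem_level_of_forall L (Subgroup.mul_mem _ (Subgroup.inv_mem _ hwp) hg) hwq
  rw [conjMap_eq_conjMap_of_inv_mul_mem T'.toTopRep hmem, hwfix]

open scoped commutatorElement in
/-- The conjugation operators of two elements of `Γ_K` commute on `H¹(U_r, T')` (the quotient
`Γ_K ⧸ U_r` is abelian). [folklore] -/
theorem commute_conjMap_hom_level (i : ι) (r : Finset (HeightOneSpectrum (𝓞 K))) (a b : absoluteGaloisGroup K) :
    Commute (conjMap T'.toTopRep (L.level i r) a 1).hom.toLinearMap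
      (conjMap T'.toTopRep (L.level i r) b 1).hom.toLinearMap := by
  refine commute_conjMap_hom T'.toTopRep (L.commutator_le_level i r ?_)
  have e : a⁻¹ * b⁻¹ * a * b = ⁅a⁻¹, b⁻¹⁆ := by
    rw [commutatorElement_def, inv_inv, inv_inv]
  rw [e, commutator_def]
  exact Subgroup.commutator_mem_commutator (Subgroup.mem_top _) (Subgroup.mem_top _)

/-- The derivative operators `D_ℓ = Σ_{j<N_ℓ} j E_ℓ^j` of the chosen generators pairwise commute on
`H¹(U_r, T')` (the input `comm` of `Finset.noncommProd`). [folklore] -/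
theorem pairwise_commute_deriv (i : ι) (r : Finset (HeightOneSpectrum (𝓞 K)))
    (σ : HeightOneSpectrum (𝓞 K) → absoluteGaloisGroup K) (N : HeightOneSpectrum (𝓞 K) → ℕ) :
    (r : Set (HeightOneSpectrum (𝓞 K))).Pairwise fun a b => Commute
      (∑ j ∈ range (N a), (j : Module.End A (continuousCohomology 1
        (subgroupRep T'.toTopRep (L.level i r)))) *
        (conjMap T'.toTopRep (L.level i r) (σ a) 1).hom.toLinearMap ^ j)
      (∑ j ∈ range (N b), (j : Module.End A (continuousCohomology 1
        (subgroupRep T'.toTopRep (L.level i r)))) *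
        (conjMap T'.toTopRep (L.level i r) (σ b) 1).hom.toLinearMap ^ j) :=
  fun a _ b _ _ => commute_deriv_deriv (fun a b => commute_conjMap_hom_level i r (σ a) (σ b)) N a b

/-- **THEOREM A2 with hypothesis (h4) displayed** (referee-1 ACK-1 GEN 26 proviso (ii)): under the
hypotheses of the module docstring, and ASSUMING that each `Fr_ℓ⁻¹` fixes every vector of
`H¹(U_r, T')` fixed by all `σ_q` (`hF`; discharged in `conjMap_deriv_eq` from `hcov` + `hσ`), every
`σ_q`, `q ∈ r`, fixes `D_r (red_* c_{i,r})`.  The product `D_r` is `r.1.noncommProd` of the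
derivative operators for ANY proof `comm` of their pairwise commutation (e.g.
`pairwise_commute_deriv`).  Proof: the restricted-and-reduced classes
`x_s = red_* res c_{i,s}` (`s ⊆ r`) form an Euler family for F1's
`apply_noncommProd_deriv_apply_eq_of_eulerFamily`. [cite: Rubin2000, Lemma 4.4.2] -/
theorem sigma_deriv_eq_of_hF (hc : IsEulerSystem L T p c) (red : T.toTopRep ⟶ T'.toTopRep)
    (i : ι) (r : L.Ideals)
    (σ : HeightOneSpectrum (𝓞 K) → absoluteGaloisGroup K) (N : HeightOneSpectrum (𝓞 K) → ℕ)
    (Fr : HeightOneSpectrum (𝓞 K) → absoluteGaloisGroup K)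
    (hσp : ∀ ℓ ∈ r.1, σ ℓ ∈ L.pLevel i)
    (hσ : ∀ ℓ ∈ r.1, ∀ q ∈ r.1, q ≠ ℓ → σ ℓ ∈ L.tameLevel q)
    (hcov : ∀ ℓ ∈ r.1, ∀ g : absoluteGaloisGroup K, ∃ j < N ℓ, (σ ℓ ^ j)⁻¹ * g ∈ L.tameLevel ℓ)
    (hinj : ∀ ℓ ∈ r.1, ∀ j₁ < N ℓ, ∀ j₂ < N ℓ, (σ ℓ ^ j₁)⁻¹ * σ ℓ ^ j₂ ∈ L.tameLevel ℓ → j₁ = j₂)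
    (hFr : ∀ ℓ ∈ r.1, IsArithFrobAtPlace K ℓ (Fr ℓ))
    (hram : ∀ ℓ ∈ r.1, ∀ s ⊆ r.1, ℓ ∉ s → ¬ SubgroupIsUnramifiedAt K (L.level i (insert ℓ s)) ℓ)
    (hM₁ : ∀ ℓ ∈ r.1, ∀ v : M', (N ℓ : A) • v = 0)
    (hM₂ : ∀ ℓ ∈ r.1, ∀ v : M',
      (rubinEulerFactor T.toRepresentation (cyclotomicCharacterToUnits K p A) (Fr ℓ)).eval 1 • v = 0)
    (hF : ∀ ℓ ∈ r.1, ∀ y : continuousCohomology 1 (subgroupRep T'.toTopRep (L.level i r.1)),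
      (∀ q ∈ r.1, conjMap T'.toTopRep (L.level i r.1) (σ q) 1 y = y) →
        conjMap T'.toTopRep (L.level i r.1) (Fr ℓ)⁻¹ 1 y = y)
    (comm) (q : HeightOneSpectrum (𝓞 K)) (hq : q ∈ r.1) :
    conjMap T'.toTopRep (L.level i r.1) (σ q) 1
        ((r.1.noncommProd (fun ℓ => ∑ j ∈ range (N ℓ), (j : Module.End A (continuousCohomology 1
          (subgroupRep T'.toTopRep (L.level i r.1)))) *
          (conjMap T'.toTopRep (L.level i r.1) (σ ℓ) 1).hom.toLinearMap ^ j) comm)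
        (ContinuousCohomology.map (ContinuousMonoidHom.id _) (X := subgroupRep T.toTopRep (L.level i r.1))
          (Y := subgroupRep T'.toTopRep (L.level i r.1)) ((TopRep.resFunctor (L.level i r.1).subtype).map red)
          1 (c i r))) =
      (r.1.noncommProd (fun ℓ => ∑ j ∈ range (N ℓ), (j : Module.End A (continuousCohomology 1
          (subgroupRep T'.toTopRep (L.level i r.1)))) *
          (conjMap T'.toTopRep (L.level i r.1) (σ ℓ) 1).hom.toLinearMap ^ j) comm)
        (ContinuousCohomology.map (ContinuousMonoidHom.id _) (X := subgroupRep T.toTopRep (L.level i r.1))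
          (Y := subgroupRep T'.toTopRep (L.level i r.1)) ((TopRep.resFunctor (L.level i r.1).subtype).map red)
          1 (c i r)) := by
  classical
  -- notation
  set U : Subgroup (absoluteGaloisGroup K) := L.level i r.1 with hUdef
  let X := continuousCohomology 1 (subgroupRep T'.toTopRep U)
  let E : HeightOneSpectrum (𝓞 K) → Module.End A X := fun ℓ => (conjMap T'.toTopRep U (σ ℓ) 1).hom.toLinearMap
  let F : HeightOneSpectrum (𝓞 K) → Module.End A X := fun ℓ => frobeniusInvOp T' U (Fr ℓ)
  let P : HeightOneSpectrum (𝓞 K) → A[X] := fun ℓ =>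
    rubinEulerFactor T.toRepresentation (cyclotomicCharacterToUnits K p A) (Fr ℓ)
  let redU : H1 T U →ₗ[A] X := (ContinuousCohomology.map (ContinuousMonoidHom.id _)
    (X := subgroupRep T.toTopRep U) (Y := subgroupRep T'.toTopRep U)
    ((TopRep.resFunctor U.subtype).map red) 1).hom.toLinearMap
  -- `U ≤ U_s` for `s ⊆ r`, and the family
  have hUle : ∀ {s : Finset (HeightOneSpectrum (𝓞 K))}, s ⊆ r.1 → U ≤ L.level i s :=
    fun hs => level_antitone L i hs
  let x : Finset (HeightOneSpectrum (𝓞 K)) → X := fun s =>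
    if hs : s ⊆ r.1 then redU (resLe T.toTopRep (hUle hs) 1 (c i ⟨s, fun q hq => r.2 q (hs hq)⟩)) else 0
  have hx : ∀ {s} (hs : s ⊆ r.1),
      x s = redU (resLe T.toTopRep (hUle hs) 1 (c i ⟨s, fun q hq => r.2 q (hs hq)⟩)) :=
    fun hs => dif_pos hs
  -- basic group facts
  have hσN : ∀ ℓ ∈ r.1, σ ℓ ^ N ℓ ∈ U := fun ℓ hℓ =>
    mem_level_of_forall L (Subgroup.pow_mem _ (hσp ℓ hℓ) _) fun q hq => by
      by_cases hqℓ : q = ℓ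
      · subst hqℓ; exact pow_mem_tameLevel_of_cov_inj L (hcov q hq) (hinj q hq)
      · exact Subgroup.pow_mem _ (hσ ℓ hℓ q hq hqℓ) _
  have hσUs : ∀ {s} (hs : s ⊆ r.1), ∀ ℓ ∈ r.1, ℓ ∉ s → σ ℓ ∈ L.level i s :=
    fun hs ℓ hℓ hℓs => mem_level_of_forall L (hσp ℓ hℓ) fun q hq =>
      hσ ℓ hℓ q (hs hq) (fun h => hℓs (h ▸ hq))
  -- the operators commute
  have hEE : ∀ a b, Commute (E a) (E b) := fun a b => commute_conjMap_hom_level i r.1 (σ a) (σ b)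
  have hFE : ∀ a b, Commute (F a) (E b) := fun a b => commute_conjMap_hom_level i r.1 (Fr a)⁻¹ (σ b)
  -- (hfix) `σ_ℓ` fixes `x_s` for `ℓ ∉ s`
  have hfix : ∀ s ⊆ r.1, ∀ ℓ ∈ r.1, ℓ ∉ s → E ℓ (x s) = x s := by
    intro s hs ℓ hℓ hℓs
    rw [hx hs]
    change conjMap T'.toTopRep U (σ ℓ) 1 (redU _) = _
    change conjMap T'.toTopRep U (σ ℓ) 1 (ContinuousCohomology.map (ContinuousMonoidHom.id _)
      (X := subgroupRep T.toTopRep U) (Y := subgroupRep T'.toTopRep U)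
      ((TopRep.resFunctor U.subtype).map red) 1 _) = _
    rw [← red_conjMap, ← resLe_conjMap, conjMap_eq_self_of_mem T.toTopRep (hσUs hs ℓ hℓ hℓs)]
    rfl
  -- (hord) `σ_ℓ^{N_ℓ}` acts trivially
  have hord : ∀ s ⊆ r.1, ∀ ℓ ∈ s, (E ℓ ^ N ℓ) (x s) = x s := by
    intro s hs ℓ hℓ
    change ((conjMap T'.toTopRep U (σ ℓ) 1).hom.toLinearMap ^ N ℓ) (x s) = x s
    rw [conjMap_hom_pow_apply, conjMap_eq_self_of_mem T'.toTopRep (hσN ℓ (hs hℓ))]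
  -- (hnorm) the norm relations, from F3a
  have hnorm : ∀ s ⊆ r.1, ∀ ℓ ∈ s,
      (∑ j ∈ range (N ℓ), E ℓ ^ j) (x s) = aeval (F ℓ) (P ℓ) (x (s.erase ℓ)) := by
    intro s hs ℓ hℓ
    have hs' : s.erase ℓ ⊆ r.1 := (Finset.erase_subset ℓ s).trans hs
    have hℓs' : ℓ ∉ s.erase ℓ := Finset.notMem_erase ℓ s
    let r₀ : L.Ideals := ⟨s.erase ℓ, fun q hq => r.2 q (hs' hq)⟩
    have hℓp : ℓ ∈ L.primes := r.2 ℓ (hs hℓ)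
    have hcons : (r₀.cons ℓ hℓp).1 = s := Finset.insert_erase hℓ
    have hsub : (⟨s, fun q hq => r.2 q (hs hq)⟩ : L.Ideals) = r₀.cons ℓ hℓp := Subtype.ext hcons.symm
    have hUc : U ≤ L.level i (r₀.cons ℓ hℓp).1 := hcons.symm ▸ hUle hs
    -- the level-coset forms of `hcov` / `hinj` / membership for F3a
    have hσ₀ : σ ℓ ∈ L.level i r₀.1 := hσUs hs' ℓ (hs hℓ) hℓs'
    have hcov₀ : ∀ g ∈ L.level i r₀.1, ∃ j < N ℓ, (σ ℓ ^ j)⁻¹ * g ∈ L.level i (r₀.cons ℓ hℓp).1 := by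
      intro g hg
      obtain ⟨j, hj, hjg⟩ := hcov ℓ (hs hℓ) g
      refine ⟨j, hj, ?_⟩
      rw [EulerSystemLevels.Ideals.cons_val]
      have hmem : (σ ℓ ^ j)⁻¹ * g ∈ L.level i r₀.1 :=
        Subgroup.mul_mem _ (Subgroup.inv_mem _ (Subgroup.pow_mem _ hσ₀ j)) hg
      rw [EulerSystemLevels.mem_level_iff] at hmem ⊢
      refine ⟨hmem.1, fun q hq => ?_⟩
      rcases Finset.mem_insert.mp hq with rfl | hq
      · exact hjg
      · exact hmem.2 q hq
    have hinj₀ : ∀ j₁ < N ℓ, ∀ j₂ < N ℓ,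
        (σ ℓ ^ j₁)⁻¹ * σ ℓ ^ j₂ ∈ L.level i (r₀.cons ℓ hℓp).1 → j₁ = j₂ := by
      intro j₁ hj₁ j₂ hj₂ hmem
      rw [EulerSystemLevels.Ideals.cons_val, EulerSystemLevels.mem_level_iff] at hmem
      exact hinj ℓ (hs hℓ) j₁ hj₁ j₂ hj₂ (hmem.2 ℓ (Finset.mem_insert_self ℓ _))
    have hram₀ : ¬ SubgroupIsUnramifiedAt K (L.level i (r₀.cons ℓ hℓp).1) ℓ := by
      rw [EulerSystemLevels.Ideals.cons_val]
      exact hram ℓ (hs hℓ) (s.erase ℓ) hs' hℓs'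
    have key := sum_conjMap_pow_red_eq_aeval hc red i r₀ ℓ hℓp hℓs' hram₀ (Fr ℓ) (hFr ℓ (hs hℓ))
      hUc (σ ℓ) (N ℓ) hσ₀ hcov₀ hinj₀
    -- rewrite the family members
    rw [hx hs, hx hs', LinearMap.sum_apply]
    have hcs : resLe T.toTopRep (hUle hs) 1 (c i ⟨s, fun q hq => r.2 q (hs hq)⟩) =
        resLe T.toTopRep hUc 1 (c i (r₀.cons ℓ hℓp)) := by
      clear key hcov₀ hinj₀ hram₀
      revert hUc
      rw [← hsub]
      intro hUc
      rfl
    have hEpow : ∀ (j : ℕ) (y : X), (E ℓ ^ j) y = conjMap T'.toTopRep U (σ ℓ ^ j) 1 y :=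
      fun j y => conjMap_hom_pow_apply T'.toTopRep (σ ℓ) j y
    rw [Finset.sum_congr rfl fun j _ => hEpow j _]
    change ∑ j ∈ range (N ℓ), conjMap T'.toTopRep U (σ ℓ ^ j) 1
        (ContinuousCohomology.map (ContinuousMonoidHom.id _) (X := subgroupRep T.toTopRep U)
          (Y := subgroupRep T'.toTopRep U) ((TopRep.resFunctor U.subtype).map red) 1 _) =
      aeval (F ℓ) (P ℓ) (ContinuousCohomology.map (ContinuousMonoidHom.id _)
        (X := subgroupRep T.toTopRep U) (Y := subgroupRep T'.toTopRep U)
        ((TopRep.resFunctor U.subtype).map red) 1 _)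
    rw [hcs]
    exact key
  -- (hN), (hP): `N_ℓ` and `P_ℓ(1)` kill `X`
  have hN : ∀ ℓ ∈ r.1, ∀ y : X, (N ℓ : A) • y = 0 := fun ℓ hℓ y =>
    smul_eq_zero_of_forall_smul_eq_zero T'.toTopRep _ (hM₁ ℓ hℓ) y
  have hP : ∀ ℓ ∈ r.1, ∀ y : X, (P ℓ).eval 1 • y = 0 := fun ℓ hℓ y =>
    smul_eq_zero_of_forall_smul_eq_zero T'.toTopRep _ (hM₂ ℓ hℓ) y
  -- (hF)
  have hF' : ∀ ℓ ∈ r.1, ∀ y : X, (∀ q ∈ r.1, E q y = y) → F ℓ y = y := fun ℓ hℓ y hy =>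
    hF ℓ hℓ y hy
  -- the abstract theorem at `s = r.1`
  have main := apply_noncommProd_deriv_apply_eq_of_eulerFamily E F N P r.1 x hEE hFE hfix hord hnorm
    hN hP hF' r.1 subset_rfl q hq
  -- `x r.1 = red_* c_{i,r}`
  have hxr : x r.1 = redU (c i r) := by
    rw [hx subset_rfl]
    exact congrArg redU (resLe_refl_apply T.toTopRep (c i r))
  rw [hxr] at main
  exact main

/-- **THEOREM A2 — Kolyvagin's derivative classes are Galois-invariant** ([Rubin00] Lemma 4.4.2
for the tree's `IsEulerSystem`): with the data and hypotheses of the module docstring (chosen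
generators `σ_ℓ` with `hσp`/`hσ`/`hcov`/`hinj`, arithmetic Frobenii `Fr_ℓ` in the `p`-level with the
levels ramified at `ℓ`, and `T'` killed by `N_ℓ` and `P_ℓ(1)`), every `g ∈ Gal(K̄/F_i)` — all of
`Γ_K` at the bottom layer `i = ⊥` — fixes `D_r (red_* c_{i,r}) ∈ H¹(Gal(K̄/F_i(r)), T')`.  Hypothesis
(h4) of F1 is discharged here by `conjMap_eq_self_of_forall_sigma` (the `σ_ℓ` generate `Γ_K ⧸ U_r`).
[cite: Rubin2000, Lemma 4.4.2] -/
theorem conjMap_deriv_eq (hc : IsEulerSystem L T p c) (red : T.toTopRep ⟶ T'.toTopRep)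
    (i : ι) (r : L.Ideals)
    (σ : HeightOneSpectrum (𝓞 K) → absoluteGaloisGroup K) (N : HeightOneSpectrum (𝓞 K) → ℕ)
    (Fr : HeightOneSpectrum (𝓞 K) → absoluteGaloisGroup K)
    (hσp : ∀ ℓ ∈ r.1, σ ℓ ∈ L.pLevel i)
    (hσ : ∀ ℓ ∈ r.1, ∀ q ∈ r.1, q ≠ ℓ → σ ℓ ∈ L.tameLevel q)
    (hcov : ∀ ℓ ∈ r.1, ∀ g : absoluteGaloisGroup K, ∃ j < N ℓ, (σ ℓ ^ j)⁻¹ * g ∈ L.tameLevel ℓ)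
    (hinj : ∀ ℓ ∈ r.1, ∀ j₁ < N ℓ, ∀ j₂ < N ℓ, (σ ℓ ^ j₁)⁻¹ * σ ℓ ^ j₂ ∈ L.tameLevel ℓ → j₁ = j₂)
    (hFrp : ∀ ℓ ∈ r.1, Fr ℓ ∈ L.pLevel i) (hFr : ∀ ℓ ∈ r.1, IsArithFrobAtPlace K ℓ (Fr ℓ))
    (hram : ∀ ℓ ∈ r.1, ∀ s ⊆ r.1, ℓ ∉ s → ¬ SubgroupIsUnramifiedAt K (L.level i (insert ℓ s)) ℓ)
    (hM₁ : ∀ ℓ ∈ r.1, ∀ v : M', (N ℓ : A) • v = 0)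
    (hM₂ : ∀ ℓ ∈ r.1, ∀ v : M',
      (rubinEulerFactor T.toRepresentation (cyclotomicCharacterToUnits K p A) (Fr ℓ)).eval 1 • v = 0)
    (comm) (g : absoluteGaloisGroup K) (hg : g ∈ L.pLevel i) :
    conjMap T'.toTopRep (L.level i r.1) g 1
        ((r.1.noncommProd (fun ℓ => ∑ j ∈ range (N ℓ), (j : Module.End A (continuousCohomology 1
          (subgroupRep T'.toTopRep (L.level i r.1)))) *
          (conjMap T'.toTopRep (L.level i r.1) (σ ℓ) 1).hom.toLinearMap ^ j) comm)
        (ContinuousCohomology.map (ContinuousMonoidHom.id _) (X := subgroupRep T.toTopRep (L.level i r.1))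
          (Y := subgroupRep T'.toTopRep (L.level i r.1)) ((TopRep.resFunctor (L.level i r.1).subtype).map red)
          1 (c i r))) =
      (r.1.noncommProd (fun ℓ => ∑ j ∈ range (N ℓ), (j : Module.End A (continuousCohomology 1
          (subgroupRep T'.toTopRep (L.level i r.1)))) *
          (conjMap T'.toTopRep (L.level i r.1) (σ ℓ) 1).hom.toLinearMap ^ j) comm)
        (ContinuousCohomology.map (ContinuousMonoidHom.id _) (X := subgroupRep T.toTopRep (L.level i r.1))
          (Y := subgroupRep T'.toTopRep (L.level i r.1)) ((TopRep.resFunctor (L.level i r.1).subtype).map red)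
          1 (c i r)) := by
  -- (h4): `Fr_ℓ⁻¹` fixes the common fixed vectors of the `σ_q`
  have hF : ∀ ℓ ∈ r.1, ∀ y : continuousCohomology 1 (subgroupRep T'.toTopRep (L.level i r.1)),
      (∀ q ∈ r.1, conjMap T'.toTopRep (L.level i r.1) (σ q) 1 y = y) →
        conjMap T'.toTopRep (L.level i r.1) (Fr ℓ)⁻¹ 1 y = y := fun ℓ hℓ y hy =>
    conjMap_eq_self_of_forall_sigma i r.1 σ N hσp hσ hcov y hy (Fr ℓ)⁻¹
      (Subgroup.inv_mem _ (hFrp ℓ hℓ))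
  exact conjMap_eq_self_of_forall_sigma i r.1 σ N hσp hσ hcov _
    (fun q hq => sigma_deriv_eq_of_hF hc red i r σ N Fr hσp hσ hcov hinj hFr hram hM₁ hM₂ hF comm q hq)
    g hg

end Classes

end Derivative

end Summit.BirchSwinnertonDyer.Rank1Residual.GaloisImage

end
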